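import Summits.HodgeConjecture.HodgeConjecture.Theorems.K2E5QuatAdelicCoordinates   -- ★ (p16): `quatCoordEquiv : 𝔸⁺⁴ ≃ₜ+ D_{h,𝔸}`; brings ★ #3g `K2E5QuatZetaDefs` (`quatZeta`, `quatModule`, `quatSchwartzBruhat`) and ★ #3d
import HarnessLib

/-!
# K2 ∕ E5 «TamagawaUnitary» — tier-2 file `K2E5QuatZetaAbsConvReduction`: the SOFT half of the absolute convergence of `Z_h(Φ, s)` (continuity, measurability,
# reduction to a real majorant, monotonicity in `σ` on the two halves of the module)

Track B «K2-LIT», engine E5, crux H413 (`stmt-HodgeConjecture-24833`), route `route-HodgeConjecture-HCCMUnconditional`; seat K2E5-p07 (g0), layer (α) of the deal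
DEALS BATCH #8 (g) «`Theorems/K2E5QuatZetaAbsConv.lean`: absolute convergence of the `quatZeta` integrand for real `s > 1`» (K2E5-plan, 2026-09-03).  HONEST SCOPE: this file
does NOT prove the convergence; it proves everything about the integrand of ★ #3g `quatZeta L h dx Φ s = ∫ Φ(x) |det x|_𝔸^s dx` that does not depend on the place-by-place
structure of the Haar measure of `(D_h ⊗ 𝔸)^× = quatAdelicUnits` (absent from the tree today; census `K2/K2E5-p07/g0/QuatZetaAbsConv-CORE-census.md`), so that the CORE
estimate — `∀ σ > 1, Integrable (x ↦ ‖Φ x‖ · (quatModule x)^σ) dx` — is the ONLY thing left for the successor socket (layer (β)):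
* §1 `continuous_testFunction_restrict` — a transported Schwartz–Bruhat function `Φ ∈ quatSchwartzBruhat L e` (★ #3g: `Φ ∘ quatCoord e ∈ 𝒮(𝔸⁺⁴)`) is CONTINUOUS on `(D_h ⊗ 𝔸)^×`
  (through ★ `quatCoordEquiv⁻¹`, ★ `continuous_of_mem_piSchwartzBruhat`; `Φ` itself is arbitrary off `D_{h,𝔸}`), hence the `quatZeta` integrand is continuous
  (`continuous_quatZeta_integrand`; `|det x|_𝔸 > 0` lies in the slit plane) and a.e. strongly measurable for every measure (`aestronglyMeasurable_quatZeta_integrand`);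
* §2 `integrable_quatZeta_integrand_iff` — for REAL `s`, the `ℂ`-valued integrand is integrable iff the real majorant `‖Φ x‖ · |det x|_𝔸^s` is (★ `norm_quatZeta_integrand`);
* §3 monotonicity in `σ` of the majorant on `{1 ≤ |det x|_𝔸}` (decreasing `σ`) and on `{|det x|_𝔸 ≤ 1}` (increasing `σ`), and the two-halves criterion
  `integrable_majorant_of_halves` — Tate's splitting `Z = Z^{≥1} + Z^{≤1}`.
No `sorry`, axioms ⊆ the trio, no `instance`, no `notation`.

HONEST LABEL: HC_CM is proved only modulo the 7 printed citations (2 remaining named inputs: hLiu418 = stmt-HodgeConjecture-24832, h413 = stmt-HodgeConjecture-24833) until rung 0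
closes; this file is a helper (`--supports stmt-HodgeConjecture-24833 --as helper`) and changes no count.

## References
[VignerasLNM800] M.-F. Vignéras, *Arithmétique des algèbres de quaternions*, LNM 800 (1980), Ch. III §2 Thm. 2.2 («Z_X(Φ, s) converge pour Re s > 1») · [WeilBNT1967] A. Weil, *Basic
Number Theory* (1967), Ch. VII §5–§6; Ch. XI §1 (zeta integrals of simple algebras: the split at module `1`) · [TateThesis1967] J. Tate, in Cassels–Fröhlich (1967), Ch. XV §4.4.
-/

set_option autoImplicit false
set_option linter.dupNamespace false

noncomputable section

namespace Summit.HodgeConjecture.HodgeConjecture.Cruxes.H413.K2E5QuatZetaAbsConvReduction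

open NumberField IsDedekindDomain MeasureTheory Topology
open scoped Matrix MatrixGroups NNReal
open Literature.NumberTheory Literature.NumberTheory.Automorphic
open Summit.HodgeConjecture.HodgeConjecture.Cruxes.H413.K2E5QuatAdelicMatrixModel
open Summit.HodgeConjecture.HodgeConjecture.Cruxes.H413.K2E5QuatZeta
open Summit.HodgeConjecture.HodgeConjecture.Cruxes.H413.K2E5QuatAdelicCoordinates

variable (L : Type) [Field L] [NumberField L] [IsCMField L] {Ha : Matrix (Fin 2) (Fin 2) L}
  (hHa : (Ha.map (cmConjRingHom L)).transpose = Ha) (hdet : Ha.det ≠ 0)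

/-! ## §1 Continuity and measurability of the integrand on `(D_h ⊗ 𝔸)^×` -/

/-- The inclusion `(D_h ⊗ 𝔸)^× → D_{h,𝔸}` (★ #3d `mem_quatAdelicUnits_iff`) is continuous (units topology → matrix topology → subtype). [cite: VignerasLNM800, Ch. III §1 (unités de X_A)] -/
theorem continuous_unitsToQuatAdelic :
    Continuous fun x : ↥(quatAdelicUnits L Ha) =>
      (⟨((x : GL (Fin 2) (AdeleRing (𝓞 L) L)) : Matrix (Fin 2) (Fin 2) (AdeleRing (𝓞 L) L)), (mem_quatAdelicUnits_iff L Ha _).1 x.2⟩ : ↥(quatAdelic L Ha)) :=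
  (Units.continuous_val.comp continuous_subtype_val).subtype_mk _

/-- **A test function restricted to `(D_h ⊗ 𝔸)^×` factors through its coordinates**: `Φ(x) = (Φ ∘ quatCoord e)(quatCoordEquiv⁻¹ x)`. [cite: VignerasLNM800, Ch. III §1] -/
theorem testFunction_eq_comp_coord (Φ : Matrix (Fin 2) (Fin 2) (AdeleRing (𝓞 L) L) → ℂ) (x : ↥(quatAdelicUnits L Ha)) :
    Φ ((x : GL (Fin 2) (AdeleRing (𝓞 L) L)) : Matrix (Fin 2) (Fin 2) (AdeleRing (𝓞 L) L)) =
      (fun a => Φ (quatCoord L (fun i => ((quatBasis L Ha hHa hdet i : ↥(quatRatSubalgebra L Ha)) : Matrix (Fin 2) (Fin 2) L)) a))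
        ((quatCoordEquiv L hHa hdet).symm
          ⟨((x : GL (Fin 2) (AdeleRing (𝓞 L) L)) : Matrix (Fin 2) (Fin 2) (AdeleRing (𝓞 L) L)), (mem_quatAdelicUnits_iff L Ha _).1 x.2⟩) := by
  have h := congrArg (fun y : ↥(quatAdelic L Ha) => (y : Matrix (Fin 2) (Fin 2) (AdeleRing (𝓞 L) L)))
    ((quatCoordEquiv L hHa hdet).apply_symm_apply
      ⟨((x : GL (Fin 2) (AdeleRing (𝓞 L) L)) : Matrix (Fin 2) (Fin 2) (AdeleRing (𝓞 L) L)), (mem_quatAdelicUnits_iff L Ha _).1 x.2⟩)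
  simp only [coe_quatCoordEquiv] at h
  exact congrArg Φ h.symm

/-- **A transported Schwartz–Bruhat function is continuous on `(D_h ⊗ 𝔸)^×`** (★ `continuous_of_mem_piSchwartzBruhat` through ★ `quatCoordEquiv⁻¹`).
[cite: VignerasLNM800, Ch. III §2 (fonctions de Schwartz–Bruhat sur X_A)] [cite: TateThesis1967, §4.4] -/
theorem continuous_testFunction_restrict {Φ : Matrix (Fin 2) (Fin 2) (AdeleRing (𝓞 L) L) → ℂ}
    (hΦ : Φ ∈ quatSchwartzBruhat L (fun i => ((quatBasis L Ha hHa hdet i : ↥(quatRatSubalgebra L Ha)) : Matrix (Fin 2) (Fin 2) L))) :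
    Continuous fun x : ↥(quatAdelicUnits L Ha) => Φ ((x : GL (Fin 2) (AdeleRing (𝓞 L) L)) : Matrix (Fin 2) (Fin 2) (AdeleRing (𝓞 L) L)) := by
  have hc := continuous_of_mem_piSchwartzBruhat ((mem_quatSchwartzBruhat_iff L _ Φ).1 hΦ)
  have h : (fun x : ↥(quatAdelicUnits L Ha) => Φ ((x : GL (Fin 2) (AdeleRing (𝓞 L) L)) : Matrix (Fin 2) (Fin 2) (AdeleRing (𝓞 L) L))) =
      (fun a => Φ (quatCoord L (fun i => ((quatBasis L Ha hHa hdet i : ↥(quatRatSubalgebra L Ha)) : Matrix (Fin 2) (Fin 2) L)) a)) ∘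
        (quatCoordEquiv L hHa hdet).symm ∘ (fun x : ↥(quatAdelicUnits L Ha) =>
          (⟨((x : GL (Fin 2) (AdeleRing (𝓞 L) L)) : Matrix (Fin 2) (Fin 2) (AdeleRing (𝓞 L) L)), (mem_quatAdelicUnits_iff L Ha _).1 x.2⟩ : ↥(quatAdelic L Ha))) :=
    funext fun x => testFunction_eq_comp_coord L hHa hdet Φ x
  rw [h]
  exact hc.comp ((quatCoordEquiv L hHa hdet).symm.continuous.comp (continuous_unitsToQuatAdelic L))

/-- `x ↦ (|det x|_𝔸 : ℂ) ^ s` is continuous on `(D_h ⊗ 𝔸)^×` (the base is a positive real: slit plane). [folklore] -/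
theorem continuous_quatModule_cpow (s : ℂ) : Continuous fun x : ↥(quatAdelicUnits L Ha) => (((quatModule L Ha x : ℝ≥0) : ℝ) : ℂ) ^ s :=
  (Complex.continuous_ofReal.comp (continuous_quatModule L Ha)).cpow continuous_const fun x =>
    Or.inl (by simpa only [Function.comp_apply, Complex.ofReal_re] using quatModule_pos L Ha x)

/-- **The `quatZeta` integrand is continuous** for `Φ ∈ quatSchwartzBruhat`. [cite: VignerasLNM800, Ch. III §2] -/
theorem continuous_quatZeta_integrand {Φ : Matrix (Fin 2) (Fin 2) (AdeleRing (𝓞 L) L) → ℂ}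
    (hΦ : Φ ∈ quatSchwartzBruhat L (fun i => ((quatBasis L Ha hHa hdet i : ↥(quatRatSubalgebra L Ha)) : Matrix (Fin 2) (Fin 2) L))) (s : ℂ) :
    Continuous fun x : ↥(quatAdelicUnits L Ha) =>
      Φ ((x : GL (Fin 2) (AdeleRing (𝓞 L) L)) : Matrix (Fin 2) (Fin 2) (AdeleRing (𝓞 L) L)) * (((quatModule L Ha x : ℝ≥0) : ℝ) : ℂ) ^ s :=
  (continuous_testFunction_restrict L hHa hdet hΦ).mul (continuous_quatModule_cpow L s)

/-- **The real majorant `‖Φ x‖ · |det x|_𝔸^σ` is continuous.** [cite: VignerasLNM800, Ch. III §2] -/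
theorem continuous_quatZeta_majorant {Φ : Matrix (Fin 2) (Fin 2) (AdeleRing (𝓞 L) L) → ℂ}
    (hΦ : Φ ∈ quatSchwartzBruhat L (fun i => ((quatBasis L Ha hHa hdet i : ↥(quatRatSubalgebra L Ha)) : Matrix (Fin 2) (Fin 2) L))) (σ : ℝ) :
    Continuous fun x : ↥(quatAdelicUnits L Ha) =>
      ‖Φ ((x : GL (Fin 2) (AdeleRing (𝓞 L) L)) : Matrix (Fin 2) (Fin 2) (AdeleRing (𝓞 L) L))‖ * ((quatModule L Ha x : ℝ≥0) : ℝ) ^ σ :=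
  (continuous_testFunction_restrict L hHa hdet hΦ).norm.mul
    ((continuous_quatModule L Ha).rpow_const fun x => Or.inl (quatModule_pos L Ha x).ne')

variable [MeasurableSpace (GL (Fin 2) (AdeleRing (𝓞 L) L))] [BorelSpace (GL (Fin 2) (AdeleRing (𝓞 L) L))]

/-- The `quatZeta` integrand is a.e. strongly measurable for EVERY measure on `(D_h ⊗ 𝔸)^×` (Borel structures). [folklore] -/
theorem aestronglyMeasurable_quatZeta_integrand {Φ : Matrix (Fin 2) (Fin 2) (AdeleRing (𝓞 L) L) → ℂ}
    (hΦ : Φ ∈ quatSchwartzBruhat L (fun i => ((quatBasis L Ha hHa hdet i : ↥(quatRatSubalgebra L Ha)) : Matrix (Fin 2) (Fin 2) L)))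
    (dx : Measure ↥(quatAdelicUnits L Ha)) (s : ℂ) :
    AEStronglyMeasurable (fun x : ↥(quatAdelicUnits L Ha) =>
      Φ ((x : GL (Fin 2) (AdeleRing (𝓞 L) L)) : Matrix (Fin 2) (Fin 2) (AdeleRing (𝓞 L) L)) * (((quatModule L Ha x : ℝ≥0) : ℝ) : ℂ) ^ s) dx :=
  (continuous_quatZeta_integrand L hHa hdet hΦ s).aestronglyMeasurable

/-! ## §2 Absolute convergence = integrability of the real majorant -/

/-- **REDUCTION TO THE REAL MAJORANT**: for real `s`, the `quatZeta` integrand `Φ(x) |det x|_𝔸^s` is `dx`-integrable iff `‖Φ x‖ · |det x|_𝔸^s` is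
(★ `norm_quatZeta_integrand`: `‖Φ(x) |det x|^s‖ = ‖Φ x‖ · |det x|^{re s}`). [cite: VignerasLNM800, Ch. III §2 Thm. 2.2] [cite: WeilBNT1967, Ch. VII §5] -/
theorem integrable_quatZeta_integrand_iff {Φ : Matrix (Fin 2) (Fin 2) (AdeleRing (𝓞 L) L) → ℂ}
    (hΦ : Φ ∈ quatSchwartzBruhat L (fun i => ((quatBasis L Ha hHa hdet i : ↥(quatRatSubalgebra L Ha)) : Matrix (Fin 2) (Fin 2) L)))
    (dx : Measure ↥(quatAdelicUnits L Ha)) (s : ℝ) :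
    Integrable (fun x : ↥(quatAdelicUnits L Ha) =>
        Φ ((x : GL (Fin 2) (AdeleRing (𝓞 L) L)) : Matrix (Fin 2) (Fin 2) (AdeleRing (𝓞 L) L)) * (((quatModule L Ha x : ℝ≥0) : ℝ) : ℂ) ^ (s : ℂ)) dx ↔
      Integrable (fun x : ↥(quatAdelicUnits L Ha) =>
        ‖Φ ((x : GL (Fin 2) (AdeleRing (𝓞 L) L)) : Matrix (Fin 2) (Fin 2) (AdeleRing (𝓞 L) L))‖ * ((quatModule L Ha x : ℝ≥0) : ℝ) ^ s) dx := by
  rw [← integrable_norm_iff (aestronglyMeasurable_quatZeta_integrand L hHa hdet hΦ dx (s : ℂ))]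
  refine integrable_congr (Filter.Eventually.of_forall fun x => ?_)
  show ‖_‖ = _
  rw [norm_quatZeta_integrand, Complex.ofReal_re]

/-! ## §3 Monotonicity in `σ` on the two halves of the module (Tate's split `Z = Z^{≥1} + Z^{≤1}`) -/

omit [NumberField L] [IsCMField L] in
/-- On `{1 ≤ |det x|_𝔸}` the majorant DECREASES with `σ`: `σ ≤ σ₀ ⇒ m^σ ≤ m^{σ₀}` for `1 ≤ m`. [folklore] -/
theorem majorant_le_of_one_le {m : ℝ} (hm : 1 ≤ m) {σ σ₀ : ℝ} (h : σ ≤ σ₀) (c : ℝ) (hc : 0 ≤ c) : c * m ^ σ ≤ c * m ^ σ₀ :=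
  mul_le_mul_of_nonneg_left (Real.rpow_le_rpow_of_exponent_le hm h) hc

omit [NumberField L] [IsCMField L] in
/-- On `{|det x|_𝔸 ≤ 1}` the majorant INCREASES with `σ`: `σ₀ ≤ σ ⇒ m^σ ≤ m^{σ₀}` for `0 < m ≤ 1`. [folklore] -/
theorem majorant_le_of_le_one {m : ℝ} (hm0 : 0 < m) (hm : m ≤ 1) {σ σ₀ : ℝ} (h : σ₀ ≤ σ) (c : ℝ) (hc : 0 ≤ c) : c * m ^ σ ≤ c * m ^ σ₀ :=
  mul_le_mul_of_nonneg_left (Real.rpow_le_rpow_of_exponent_ge hm0 hm h) hc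

/-- **`Z^{≥1}`-monotonicity**: if the majorant is integrable on `{1 ≤ |det|_𝔸}` at `σ₀`, then at every `σ ≤ σ₀`. [cite: WeilBNT1967, Ch. VII §5] [cite: TateThesis1967, §4.4] -/
theorem integrableOn_moduleGe_mono {Φ : Matrix (Fin 2) (Fin 2) (AdeleRing (𝓞 L) L) → ℂ}
    (hΦ : Φ ∈ quatSchwartzBruhat L (fun i => ((quatBasis L Ha hHa hdet i : ↥(quatRatSubalgebra L Ha)) : Matrix (Fin 2) (Fin 2) L)))
    (dx : Measure ↥(quatAdelicUnits L Ha)) {σ σ₀ : ℝ} (h : σ ≤ σ₀)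
    (hint : IntegrableOn (fun x : ↥(quatAdelicUnits L Ha) =>
        ‖Φ ((x : GL (Fin 2) (AdeleRing (𝓞 L) L)) : Matrix (Fin 2) (Fin 2) (AdeleRing (𝓞 L) L))‖ * ((quatModule L Ha x : ℝ≥0) : ℝ) ^ σ₀)
      {x | 1 ≤ ((quatModule L Ha x : ℝ≥0) : ℝ)} dx) :
    IntegrableOn (fun x : ↥(quatAdelicUnits L Ha) =>
        ‖Φ ((x : GL (Fin 2) (AdeleRing (𝓞 L) L)) : Matrix (Fin 2) (Fin 2) (AdeleRing (𝓞 L) L))‖ * ((quatModule L Ha x : ℝ≥0) : ℝ) ^ σ)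
      {x | 1 ≤ ((quatModule L Ha x : ℝ≥0) : ℝ)} dx := by
  refine Integrable.mono' hint (continuous_quatZeta_majorant L hHa hdet hΦ σ).aestronglyMeasurable.restrict ?_
  refine (ae_restrict_mem (measurableSet_le measurable_const (continuous_quatModule L Ha).measurable)).mono fun x hx => ?_
  rw [Real.norm_eq_abs, abs_of_nonneg (by positivity)]
  exact majorant_le_of_one_le hx h _ (norm_nonneg _)

/-- **`Z^{≤1}`-monotonicity**: if the majorant is integrable on `{|det|_𝔸 ≤ 1}` at `σ₀`, then at every `σ ≥ σ₀`. [cite: WeilBNT1967, Ch. VII §5] [cite: TateThesis1967, §4.4] -/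
theorem integrableOn_moduleLe_mono {Φ : Matrix (Fin 2) (Fin 2) (AdeleRing (𝓞 L) L) → ℂ}
    (hΦ : Φ ∈ quatSchwartzBruhat L (fun i => ((quatBasis L Ha hHa hdet i : ↥(quatRatSubalgebra L Ha)) : Matrix (Fin 2) (Fin 2) L)))
    (dx : Measure ↥(quatAdelicUnits L Ha)) {σ σ₀ : ℝ} (h : σ₀ ≤ σ)
    (hint : IntegrableOn (fun x : ↥(quatAdelicUnits L Ha) =>
        ‖Φ ((x : GL (Fin 2) (AdeleRing (𝓞 L) L)) : Matrix (Fin 2) (Fin 2) (AdeleRing (𝓞 L) L))‖ * ((quatModule L Ha x : ℝ≥0) : ℝ) ^ σ₀)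
      {x | ((quatModule L Ha x : ℝ≥0) : ℝ) ≤ 1} dx) :
    IntegrableOn (fun x : ↥(quatAdelicUnits L Ha) =>
        ‖Φ ((x : GL (Fin 2) (AdeleRing (𝓞 L) L)) : Matrix (Fin 2) (Fin 2) (AdeleRing (𝓞 L) L))‖ * ((quatModule L Ha x : ℝ≥0) : ℝ) ^ σ)
      {x | ((quatModule L Ha x : ℝ≥0) : ℝ) ≤ 1} dx := by
  refine Integrable.mono' hint (continuous_quatZeta_majorant L hHa hdet hΦ σ).aestronglyMeasurable.restrict ?_
  refine (ae_restrict_mem (measurableSet_le (continuous_quatModule L Ha).measurable measurable_const)).mono fun x hx => ?_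
  rw [Real.norm_eq_abs, abs_of_nonneg (by positivity)]
  exact majorant_le_of_le_one (quatModule_pos L Ha x) hx h _ (norm_nonneg _)

omit [BorelSpace (GL (Fin 2) (AdeleRing (𝓞 L) L))] in
/-- **TATE'S SPLIT**: the majorant is integrable iff it is integrable on `{1 ≤ |det|_𝔸}` and on `{|det|_𝔸 ≤ 1}` (the two sets cover). [cite: TateThesis1967, §4.4] -/
theorem integrable_majorant_of_halves {Φ : Matrix (Fin 2) (Fin 2) (AdeleRing (𝓞 L) L) → ℂ} (dx : Measure ↥(quatAdelicUnits L Ha)) {σ : ℝ}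
    (hge : IntegrableOn (fun x : ↥(quatAdelicUnits L Ha) =>
        ‖Φ ((x : GL (Fin 2) (AdeleRing (𝓞 L) L)) : Matrix (Fin 2) (Fin 2) (AdeleRing (𝓞 L) L))‖ * ((quatModule L Ha x : ℝ≥0) : ℝ) ^ σ)
      {x | 1 ≤ ((quatModule L Ha x : ℝ≥0) : ℝ)} dx)
    (hle : IntegrableOn (fun x : ↥(quatAdelicUnits L Ha) =>
        ‖Φ ((x : GL (Fin 2) (AdeleRing (𝓞 L) L)) : Matrix (Fin 2) (Fin 2) (AdeleRing (𝓞 L) L))‖ * ((quatModule L Ha x : ℝ≥0) : ℝ) ^ σ)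
      {x | ((quatModule L Ha x : ℝ≥0) : ℝ) ≤ 1} dx) :
    Integrable (fun x : ↥(quatAdelicUnits L Ha) =>
        ‖Φ ((x : GL (Fin 2) (AdeleRing (𝓞 L) L)) : Matrix (Fin 2) (Fin 2) (AdeleRing (𝓞 L) L))‖ * ((quatModule L Ha x : ℝ≥0) : ℝ) ^ σ) dx := by
  have hcover : {x : ↥(quatAdelicUnits L Ha) | 1 ≤ ((quatModule L Ha x : ℝ≥0) : ℝ)} ∪ {x | ((quatModule L Ha x : ℝ≥0) : ℝ) ≤ 1} = Set.univ :=
    Set.eq_univ_of_forall fun x => (le_total 1 ((quatModule L Ha x : ℝ≥0) : ℝ)).elim (fun h => Or.inl h) fun h => Or.inr h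
  rw [← integrableOn_univ, ← hcover]
  exact hge.union hle

/-- **THE CONVERGENCE STATEMENT, REDUCED**: for real `s`, integrability of the `quatZeta` integrand follows from integrability of the real majorant on the two halves
of the module — the form in which the core estimate (layer (β): Euler domination on `{|det| ≤ 1}`, lattice decay on `{|det| ≥ 1}`) is to be fed.
[cite: VignerasLNM800, Ch. III §2 Thm. 2.2] [cite: TateThesis1967, §4.4] -/
theorem integrable_quatZeta_integrand_of_halves {Φ : Matrix (Fin 2) (Fin 2) (AdeleRing (𝓞 L) L) → ℂ}
    (hΦ : Φ ∈ quatSchwartzBruhat L (fun i => ((quatBasis L Ha hHa hdet i : ↥(quatRatSubalgebra L Ha)) : Matrix (Fin 2) (Fin 2) L)))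
    (dx : Measure ↥(quatAdelicUnits L Ha)) {s : ℝ}
    (hge : IntegrableOn (fun x : ↥(quatAdelicUnits L Ha) =>
        ‖Φ ((x : GL (Fin 2) (AdeleRing (𝓞 L) L)) : Matrix (Fin 2) (Fin 2) (AdeleRing (𝓞 L) L))‖ * ((quatModule L Ha x : ℝ≥0) : ℝ) ^ s)
      {x | 1 ≤ ((quatModule L Ha x : ℝ≥0) : ℝ)} dx)
    (hle : IntegrableOn (fun x : ↥(quatAdelicUnits L Ha) =>
        ‖Φ ((x : GL (Fin 2) (AdeleRing (𝓞 L) L)) : Matrix (Fin 2) (Fin 2) (AdeleRing (𝓞 L) L))‖ * ((quatModule L Ha x : ℝ≥0) : ℝ) ^ s)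
      {x | ((quatModule L Ha x : ℝ≥0) : ℝ) ≤ 1} dx) :
    Integrable (fun x : ↥(quatAdelicUnits L Ha) =>
        Φ ((x : GL (Fin 2) (AdeleRing (𝓞 L) L)) : Matrix (Fin 2) (Fin 2) (AdeleRing (𝓞 L) L)) * (((quatModule L Ha x : ℝ≥0) : ℝ) : ℂ) ^ (s : ℂ)) dx :=
  (integrable_quatZeta_integrand_iff L hHa hdet hΦ dx s).2 (integrable_majorant_of_halves L dx hge hle)

end Summit.HodgeConjecture.HodgeConjecture.Cruxes.H413.K2E5QuatZetaAbsConvReduction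

end
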